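import Mathlib
import Summits.QuantumFields.YangMills.Theorems.TransportFieldFanoAdjointLoopDirichletWeak
import HarnessLib

/-!
# Crux `TransportFieldFano.AdjointLoopDirichletWeak` ⟨stmt-QuantumFields-23362⟩, line `birth`: the registered BC5 rung
# `stub_rung_fixedTorus` (the crux on the fixed torus `L = 2`) — CLOSED, as the `L = 2` instance of the proved crux

`FixedTorusRungP` (verbatim): for every `ε > 0` there are `C, β₀` with, for `β ≥ β₀`, `L = 2` and every `l2`-normalised physical eigenfunction
`Ω` at `λ₀`, `λ₀‖FΩ‖² − ⟨FΩ, K_β(FΩ)⟩ ≤ C·β^(ε−1)·λ₀·E[FΩ²]`.  It is ✓`adjointLoopDirichletWeak_proof` (the crux, poly-loss exponent `k`)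
at `L = 2`, with `C ↦ C·2^k`.
HONEST FRAMING: bookkeeping on a support crux of a DRAFT line; K2a, R2ξ″ and every rung of LADDER-YM remain OPEN; the Yang–Mills mass gap is
NOT proved.  No `sorry`, no new axiom; the `abbrev` is a registered-stub copy (verbatim), not a citable fact.
References: [cite: ReedSimonIV1978, Thm. XIII.43]; [cite: Luscher1983, §2].
-/

set_option autoImplicit false

noncomputable section

open MeasureTheory Filter Topology Real

namespace Summit.QuantumFields.YangMills.Theorems.TransportFieldFano

open Summit.QuantumFields.YangMills.Theorems.FemtoTransferGap

/-- The registered stub statement `FixedTorusRungP` of line `birth` of crux ⟨stmt-QuantumFields-23362⟩ (verbatim copy of the skeleton's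
`BirthALD.FixedTorusRungP`; a registered-stub copy, not a citable fact). -/
abbrev FixedTorusRungP : Prop :=
    ∀ ε : ℝ, 0 < ε → ∃ C β₀ : ℝ, ∀ β : ℝ, β₀ ≤ β → ∀ (L : ℕ) [NeZero L], L = 2 → ∀ Ω : Literature.MathematicalPhysics.QuantumFieldTheory.GaugeConfig 3 L SU2 → ℝ, IsPhys Ω → l2 Ω Ω = 1 → transferApply β Ω = topValue su2Rep L β • Ω → let F : Literature.MathematicalPhysics.QuantumFieldTheory.GaugeConfig 3 L SU2 → ℝ := flowLift 0 (fun u : Literature.MathematicalPhysics.QuantumFieldTheory.GaugeConfig 3 1 SU2 => 4 - ((su2Rep (u ((0 : Literature.MathematicalPhysics.QuantumFieldTheory.Site 3 1), (0 : Fin 3)))).trace.re) ^ 2); topValue su2Rep L β * l2 (fun U => F U * Ω U) (fun U => F U * Ω U) - l2 (fun U => F U * Ω U) (transferApply β (fun U => F U * Ω U)) ≤ C * β ^ (ε - 1) * topValue su2Rep L β * l2 (fun U => F U * Ω U) Ω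

/-- ★★ **`stub_rung_fixedTorus`** (registered BC5 rung of the birth skeleton of crux ⟨stmt-QuantumFields-23362⟩, signature `FixedTorusRungP`
verbatim): the Dirichlet ceiling on the fixed torus `L = 2`, as the `L = 2` instance of the proved poly-loss crux (`C ↦ C·2^k`).
[cite: ReedSimonIV1978, Thm. XIII.43] [cite: Luscher1983, §2] -/
theorem stub_rung_fixedTorus : FixedTorusRungP := by
  obtain ⟨k, hk⟩ := adjointLoopDirichletWeak_proof
  intro ε hε
  obtain ⟨C, β₀, hC⟩ := hk ε hε
  refine ⟨C * (2 : ℝ) ^ k, β₀, fun β hβ L _ hL Ω hΩ hn heig => ?_⟩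
  have h := hC β hβ L Ω hΩ hn heig
  simp only at h ⊢
  subst hL
  have h2 : ((2 : ℕ) : ℝ) ^ k = (2 : ℝ) ^ k := by norm_num
  rw [h2] at h
  calc _ ≤ C * β ^ (ε - 1) * (2 : ℝ) ^ k * topValue su2Rep 2 β * _ := h
    _ = C * (2 : ℝ) ^ k * β ^ (ε - 1) * topValue su2Rep 2 β * _ := by ring

end Summit.QuantumFields.YangMills.Theorems.TransportFieldFano

end
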